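import Literature.Probability.LatticeModels.SplitEventOfNoCrossing
import HarnessLib

/-!
# The failure of the split events is controlled by annulus crossings (Aizenman–Duminil-Copin 2021, proof of Lemma 6.7, first step, in mass form)

Topic `Literature/Probability/LatticeModels`. Theorems only: no definition and **no named fact is introduced**
(D-0026).

M. Aizenman, H. Duminil-Copin, Ann. of Math. **194** (2021) = arXiv:1912.07973, §6.2, **Lemma 6.7** (p. 24–25):
"`P^{xu,uy}[G(u₁,…,u_t)ᶜ] ≤ s(n/N)^ε`", whose proof begins: "Let `G_i` be the event that the current `𝐤_i`
exists. This event clearly contains the event that `Ann(M,N)` is not crossed by a cluster in `n_i`, and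
`Ann(n,m)` is not crossed by a cluster in `n'_i` … We focus on the probability of this event for `i ≤ t`, the
case `t < i ≤ s` being even simpler since there are no sources." The tree's `Current.splitEvent_of_noCrossing`
(`SplitEventOfNoCrossing`) is the deterministic inclusion for a SOURCED pair. This file adds:

* `Current.splitEvent_of_noCrossing_sourceless` — the same inclusion for a SOURCELESS pair (`∂n = ∂n' = ∅`,
  witness with `∂𝐤 = ∅`: "the case `t < i ≤ s`");
* `Current.tsum_epairWeight_splitFail_le` / `…_sourceless_le` — **the union bound in mass form** for one
  pair of the switched measure `P^{xu} ⊗ P^{uy}` (resp. `P^∅ ⊗ P^∅`):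
  `∑ 1{∂n={x}Δ{u}}1{∂n'={u}Δ{y}} w w 𝟙[G_uᶜ] ≤ (∑ 1{∂n={x}Δ{u}} w 𝟙[n crosses (P₃, P₄ᶜ)]) · Z[{u}Δ{y}]`
  `+ Z[{x}Δ{u}] · ∑ 1{∂n'={u}Δ{y}} w 𝟙[n' crosses (P₁, P₂ᶜ)]`,
  i.e. `P^{xu,uy}[G_uᶜ] ≤ P^{xu}[n crosses Ann(M,N)] + P^{uy}[n' crosses Ann(n,m)]` — the quantities then
  bounded by the chain rule for backbones and the sourceless crossing estimates ((6.11)–(6.13)).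

## References

* M. Aizenman, H. Duminil-Copin, Ann. of Math. 194 (2021), arXiv:1912.07973, §6.2, Lemma 6.7 and the first
  paragraph of its proof (p. 25) [AizenmanDuminilCopinAnnals2021].
* R. Panis, arXiv:2309.05797 (2023), §6.4, Lemma 6.23 ("`H_i ∩ F_i ⊂ G_i`") [Panis2023Triviality].
-/

noncomputable section

open Finset Filter
open scoped symmDiff ENNReal

namespace Literature.Probability.LatticeModels

variable {V : Type*} [Fintype V] [DecidableEq V] {G : SimpleGraph V} [DecidableRel G.Adj]

namespace Current

/-! ### The sourceless pair -/

/-- **The split event from the absence of crossings, sourceless pair** ("the case `t < i ≤ s` being even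
simpler since there are no sources"): for nested `P₁ ⊆ P₂ ⊆ P₃ ⊆ P₄`, if no cluster of `n` meets both `P₄ᶜ`
and `P₃`, no cluster of `n'` meets both `P₂ᶜ` and `P₁`, and `∂n = ∂n' = ∅`, then
`SplitEvent E_in E_out w w (n + n')` (witness with `∂𝐤 = ∅ = {w}Δ{w}`) for `E_in` inside `P₁`, `E_out` meeting
`P₄ᶜ`. [cite: AizenmanDuminilCopinAnnals2021, arXiv:1912.07973 §6.2, proof of Lemma 6.7, first paragraph (p. 25)] -/
theorem splitEvent_of_noCrossing_sourceless {P₁ P₂ P₃ P₄ : Finset V} (h12 : P₁ ⊆ P₂) (h23 : P₂ ⊆ P₃)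
    (h34 : P₃ ⊆ P₄) {n n' : Current G} (w : V)
    (hn : ∀ s, s ∉ P₄ → ∀ v ∈ P₃, v ∉ n.cluster s) (hn' : ∀ s, s ∉ P₂ → ∀ v ∈ P₁, v ∉ n'.cluster s)
    (hns : n.sources = ∅) (hn's : n'.sources = ∅)
    {Ein Eout : Finset G.edgeFinset} (hEin : ∀ e ∈ Ein, ∀ v ∈ (e : Sym2 V), v ∈ P₁)
    (hEout : ∀ e ∈ Eout, ∃ v ∈ (e : Sym2 V), v ∉ P₄) :
    SplitEvent Ein Eout w w (n + n') := by
  have hdn : Disjoint (n.clusterSet P₄ᶜ) P₃ :=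
    clusterSet_disjoint_of_noCrossing fun s hs v hv => hn s (mem_compl.1 hs) v hv
  have hdn' : Disjoint (n'.clusterSet P₂ᶜ) P₁ :=
    clusterSet_disjoint_of_noCrossing fun s hs v hv => hn' s (mem_compl.1 hs) v hv
  refine ⟨splitWitness P₂ P₄ n n', splitWitness_le P₂ P₄ n n', fun e he => ?_, fun e he => ?_, ?_⟩
  · obtain ⟨v, hv⟩ : ∃ v, v ∈ (e : Sym2 V) := by
      obtain ⟨e', he'⟩ := e
      induction e' using Sym2.ind with
      | _ a b => exact ⟨a, Sym2.mem_mk_left a b⟩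
    exact splitWitness_eq_zero_of_inside (h12.trans h23) hdn hdn' hv (hEin e he v hv)
  · obtain ⟨v, hv, hvP⟩ := hEout e he
    exact splitWitness_eq_add_of_outside (h23.trans h34) n n' hv hvP
  · unfold splitWitness
    rw [Current.sources_add, sources_restrictTo_clusterSet, sources_restrictTo_clusterSet, hns, hn's,
      Finset.empty_inter, Finset.empty_inter, symmDiff_self, symmDiff_self]

/-! ### The union bound in mass form, one pair -/

section Mass

variable {K : G.edgeFinset → ℝ}

open Classical in
/-- **`P^{xu,uy}[G_uᶜ] ≤ P^{xu}[n crosses (P₃ → P₄ᶜ)] + P^{uy}[n' crosses (P₁ → P₂ᶜ)]`, un-normalised**, for a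
sourced pair of the switched measure (`∂n = {x}Δ{u}`, `x, u ∈ P₃`; `∂n' = {u}Δ{y}`, `y ∉ P₄`), `E_in` inside
`P₁`, `E_out` meeting `P₄ᶜ`:
`∑ 1{∂n={x}Δ{u}}1{∂n'={u}Δ{y}} w w 𝟙[¬G_u(n+n')] ≤ (∑ 1{∂n={x}Δ{u}} w 𝟙[∃ s ∉ P₄, v ∈ P₃: v ∈ C_n(s)]) Z[{u}Δ{y}]`
`+ Z[{x}Δ{u}] (∑ 1{∂n'={u}Δ{y}} w 𝟙[∃ s ∉ P₂, v ∈ P₁: v ∈ C_{n'}(s)])`.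
[cite: AizenmanDuminilCopinAnnals2021, arXiv:1912.07973 §6.2, proof of Lemma 6.7, first paragraph (p. 25)] -/
theorem tsum_epairWeight_splitFail_le {P₁ P₂ P₃ P₄ : Finset V} (h12 : P₁ ⊆ P₂) (h23 : P₂ ⊆ P₃) (h34 : P₃ ⊆ P₄)
    {x u y : V} (hx : x ∈ P₃) (hu : u ∈ P₃) (hy : y ∉ P₄)
    {Ein Eout : Finset G.edgeFinset} (hEin : ∀ e ∈ Ein, ∀ v ∈ (e : Sym2 V), v ∈ P₁)
    (hEout : ∀ e ∈ Eout, ∃ v ∈ (e : Sym2 V), v ∉ P₄) :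
    ∑' p : Current G × Current G, epairWeight K ({x} ∆ {u}) ({u} ∆ {y}) p *
        (if SplitEvent Ein Eout u y (p.1 + p.2) then 0 else 1) ≤
      (∑' n : Current G, (if n.sources = {x} ∆ {u} then n.eweight K else 0) *
          (if ∃ s, s ∉ P₄ ∧ ∃ v ∈ P₃, v ∈ n.cluster s then 1 else 0)) * ecurrentSum K ({u} ∆ {y}) +
      ecurrentSum K ({x} ∆ {u}) *
        ∑' n' : Current G, (if n'.sources = {u} ∆ {y} then n'.eweight K else 0) *
          (if ∃ s, s ∉ P₂ ∧ ∃ v ∈ P₁, v ∈ n'.cluster s then 1 else 0) := by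
  -- pointwise union bound on the support
  have hpt : ∀ p : Current G × Current G, epairWeight K ({x} ∆ {u}) ({u} ∆ {y}) p *
      (if SplitEvent Ein Eout u y (p.1 + p.2) then 0 else 1) ≤
      epairWeight K ({x} ∆ {u}) ({u} ∆ {y}) p *
        ((if ∃ s, s ∉ P₄ ∧ ∃ v ∈ P₃, v ∈ p.1.cluster s then 1 else 0) +
          (if ∃ s, s ∉ P₂ ∧ ∃ v ∈ P₁, v ∈ p.2.cluster s then 1 else 0)) := by
    intro p
    by_cases hs : p.1.sources = {x} ∆ {u} ∧ p.2.sources = {u} ∆ {y}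
    · refine mul_le_mul' le_rfl ?_
      by_cases hG : SplitEvent Ein Eout u y (p.1 + p.2)
      · rw [if_pos hG]; exact zero_le
      · rw [if_neg hG]
        -- one of the two crossings occurs
        by_contra hlt
        push Not at hlt
        have h1 : ¬ (∃ s, s ∉ P₄ ∧ ∃ v ∈ P₃, v ∈ p.1.cluster s) := by
          intro h; rw [if_pos h] at hlt
          exact absurd hlt (not_lt.2 le_self_add)
        have h2 : ¬ (∃ s, s ∉ P₂ ∧ ∃ v ∈ P₁, v ∈ p.2.cluster s) := by
          intro h; rw [if_pos h] at hlt
          exact absurd hlt (not_lt.2 le_add_self)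
        push Not at h1 h2
        exact hG (splitEvent_of_noCrossing h12 h23 h34 (fun s hs v hv => h1 s hs v hv)
          (fun s hs v hv => h2 s hs v hv) hx hu hy hs.1 hs.2 hEin hEout)
    · unfold epairWeight
      rw [if_neg hs, zero_mul, zero_mul]
  calc ∑' p : Current G × Current G, epairWeight K ({x} ∆ {u}) ({u} ∆ {y}) p *
        (if SplitEvent Ein Eout u y (p.1 + p.2) then 0 else 1)
      ≤ ∑' p : Current G × Current G, epairWeight K ({x} ∆ {u}) ({u} ∆ {y}) p *
          ((if ∃ s, s ∉ P₄ ∧ ∃ v ∈ P₃, v ∈ p.1.cluster s then 1 else 0) +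
            (if ∃ s, s ∉ P₂ ∧ ∃ v ∈ P₁, v ∈ p.2.cluster s then 1 else 0)) := ENNReal.tsum_le_tsum hpt
    _ = ∑' p : Current G × Current G, (if p.1.sources = {x} ∆ {u} then p.1.eweight K else 0) *
          (if ∃ s, s ∉ P₄ ∧ ∃ v ∈ P₃, v ∈ p.1.cluster s then 1 else 0) *
          (if p.2.sources = {u} ∆ {y} then p.2.eweight K else 0) +
        ∑' p : Current G × Current G, (if p.1.sources = {x} ∆ {u} then p.1.eweight K else 0) *
          ((if p.2.sources = {u} ∆ {y} then p.2.eweight K else 0) *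
            (if ∃ s, s ∉ P₂ ∧ ∃ v ∈ P₁, v ∈ p.2.cluster s then 1 else 0)) := by
        rw [← ENNReal.tsum_add]
        refine tsum_congr fun p => ?_
        rw [epairWeight_eq_mul]
        ring
    _ = _ := by
        congr 1
        · rw [← tsum_mul_tsum_eq_tsum_prod (fun n : Current G => (if n.sources = {x} ∆ {u} then n.eweight K else 0) *
            (if ∃ s, s ∉ P₄ ∧ ∃ v ∈ P₃, v ∈ n.cluster s then 1 else 0))
            (fun n' : Current G => if n'.sources = {u} ∆ {y} then n'.eweight K else 0)]
          rfl
        · rw [← tsum_mul_tsum_eq_tsum_prod (fun n : Current G => if n.sources = {x} ∆ {u} then n.eweight K else 0)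
            (fun n' : Current G => (if n'.sources = {u} ∆ {y} then n'.eweight K else 0) *
              (if ∃ s, s ∉ P₂ ∧ ∃ v ∈ P₁, v ∈ n'.cluster s then 1 else 0))]
          rfl

open Classical in
/-- **The same for a sourceless pair** (`∂n = ∂n' = ∅`, event `G` with `∂𝐤 = ∅`):
`∑ 1{∂n=∅}1{∂n'=∅} w w 𝟙[¬G(n+n')] ≤ (∑ 1{∂n=∅} w 𝟙[n crosses (P₃ → P₄ᶜ)]) Z[∅] + Z[∅] (∑ 1{∂n'=∅} w 𝟙[n' crosses (P₁ → P₂ᶜ)])`.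
[cite: AizenmanDuminilCopinAnnals2021, arXiv:1912.07973 §6.2, proof of Lemma 6.7 ("the case t < i ≤ s", p. 25)] -/
theorem tsum_epairWeight_splitFail_sourceless_le {P₁ P₂ P₃ P₄ : Finset V} (h12 : P₁ ⊆ P₂) (h23 : P₂ ⊆ P₃)
    (h34 : P₃ ⊆ P₄) (w : V) {Ein Eout : Finset G.edgeFinset} (hEin : ∀ e ∈ Ein, ∀ v ∈ (e : Sym2 V), v ∈ P₁)
    (hEout : ∀ e ∈ Eout, ∃ v ∈ (e : Sym2 V), v ∉ P₄) :
    ∑' p : Current G × Current G, epairWeight K ∅ ∅ p * (if SplitEvent Ein Eout w w (p.1 + p.2) then 0 else 1) ≤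
      (∑' n : Current G, (if n.sources = ∅ then n.eweight K else 0) *
          (if ∃ s, s ∉ P₄ ∧ ∃ v ∈ P₃, v ∈ n.cluster s then 1 else 0)) * ecurrentSum K ∅ +
      ecurrentSum K ∅ *
        ∑' n' : Current G, (if n'.sources = ∅ then n'.eweight K else 0) *
          (if ∃ s, s ∉ P₂ ∧ ∃ v ∈ P₁, v ∈ n'.cluster s then 1 else 0) := by
  have hpt : ∀ p : Current G × Current G, epairWeight K ∅ ∅ p * (if SplitEvent Ein Eout w w (p.1 + p.2) then 0 else 1) ≤
      epairWeight K ∅ ∅ p *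
        ((if ∃ s, s ∉ P₄ ∧ ∃ v ∈ P₃, v ∈ p.1.cluster s then 1 else 0) +
          (if ∃ s, s ∉ P₂ ∧ ∃ v ∈ P₁, v ∈ p.2.cluster s then 1 else 0)) := by
    intro p
    by_cases hs : p.1.sources = ∅ ∧ p.2.sources = ∅
    · refine mul_le_mul' le_rfl ?_
      by_cases hG : SplitEvent Ein Eout w w (p.1 + p.2)
      · rw [if_pos hG]; exact zero_le
      · rw [if_neg hG]
        by_contra hlt
        push Not at hlt
        have h1 : ¬ (∃ s, s ∉ P₄ ∧ ∃ v ∈ P₃, v ∈ p.1.cluster s) := by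
          intro h; rw [if_pos h] at hlt
          exact absurd hlt (not_lt.2 le_self_add)
        have h2 : ¬ (∃ s, s ∉ P₂ ∧ ∃ v ∈ P₁, v ∈ p.2.cluster s) := by
          intro h; rw [if_pos h] at hlt
          exact absurd hlt (not_lt.2 le_add_self)
        push Not at h1 h2
        exact hG (splitEvent_of_noCrossing_sourceless h12 h23 h34 w (fun s hs v hv => h1 s hs v hv)
          (fun s hs v hv => h2 s hs v hv) hs.1 hs.2 hEin hEout)
    · unfold epairWeight
      rw [if_neg hs, zero_mul, zero_mul]
  calc ∑' p : Current G × Current G, epairWeight K ∅ ∅ p * (if SplitEvent Ein Eout w w (p.1 + p.2) then 0 else 1)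
      ≤ ∑' p : Current G × Current G, epairWeight K ∅ ∅ p *
          ((if ∃ s, s ∉ P₄ ∧ ∃ v ∈ P₃, v ∈ p.1.cluster s then 1 else 0) +
            (if ∃ s, s ∉ P₂ ∧ ∃ v ∈ P₁, v ∈ p.2.cluster s then 1 else 0)) := ENNReal.tsum_le_tsum hpt
    _ = ∑' p : Current G × Current G, (if p.1.sources = ∅ then p.1.eweight K else 0) *
          (if ∃ s, s ∉ P₄ ∧ ∃ v ∈ P₃, v ∈ p.1.cluster s then 1 else 0) *
          (if p.2.sources = ∅ then p.2.eweight K else 0) +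
        ∑' p : Current G × Current G, (if p.1.sources = ∅ then p.1.eweight K else 0) *
          ((if p.2.sources = ∅ then p.2.eweight K else 0) *
            (if ∃ s, s ∉ P₂ ∧ ∃ v ∈ P₁, v ∈ p.2.cluster s then 1 else 0)) := by
        rw [← ENNReal.tsum_add]
        refine tsum_congr fun p => ?_
        rw [epairWeight_eq_mul]
        ring
    _ = _ := by
        congr 1
        · rw [← tsum_mul_tsum_eq_tsum_prod (fun n : Current G => (if n.sources = ∅ then n.eweight K else 0) *
            (if ∃ s, s ∉ P₄ ∧ ∃ v ∈ P₃, v ∈ n.cluster s then 1 else 0))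
            (fun n' : Current G => if n'.sources = ∅ then n'.eweight K else 0)]
          rfl
        · rw [← tsum_mul_tsum_eq_tsum_prod (fun n : Current G => if n.sources = ∅ then n.eweight K else 0)
            (fun n' : Current G => (if n'.sources = ∅ then n'.eweight K else 0) *
              (if ∃ s, s ∉ P₂ ∧ ∃ v ∈ P₁, v ∈ n'.cluster s then 1 else 0))]
          rfl

end Mass

end Current

end Literature.Probability.LatticeModels
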